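import Summits.Ventures.HodgeRepro2.T5SU11LegendreSeries
import Summits.Ventures.HodgeRepro2.T5SU11LegendreBound
import Summits.Ventures.HodgeRepro2.T5SU11GaussLegendreTaylorError

/-!
# Lebesgue's inequality for the Legendre series: `|f − S_d f| ≤ (1 + (d + 1)²) E_d(f)`, and the
super-exponential convergence for smooth functions

The partial-sum operator `S_d` of the Legendre series is linear (`fourierLegendre_sub`, `partialSum_sub`), reproduces
every polynomial of degree `≤ d` (`partialSum_eval_eq`, row 409) and is bounded on `[−1, 1]` by the crude Lebesgue
constant `(d + 1)²`: `|c_k(g)| ≤ (2k + 1) sup |g|` (`abs_fourierLegendre_le`) and `|P_k| ≤ 1` (row 385) give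
**`|S_d g(x)| ≤ (d + 1)² sup_{[−1,1]} |g|`** (`abs_partialSum_le`). Hence, for every polynomial `p` of degree `≤ d`
with `|f − p| ≤ M` on `[−1, 1]`,

  **`|f(x) − S_d f(x)| ≤ (1 + (d + 1)²) M`**   (`abs_sub_partialSum_le_of_polynomial`, LEBESGUE'S INEQUALITY),

i.e. the Legendre series converges at least as fast as `(d + 1)²` times the best uniform polynomial approximation.
With the Taylor polynomial of row 424 (`abs_sub_taylorPoly_le`) this gives, for `f ∈ C^{d+1}(ℝ)` with
`|f^{(d+1)}| ≤ C` on `[−1, 1]`,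

  **`|f(x) − S_d f(x)| ≤ (1 + (d + 1)²) C/(d + 1)!`**   (`abs_sub_partialSum_le_of_contDiff`),

and for `f ∈ C^∞` with uniformly bounded derivatives the super-exponential convergence of the Legendre series
(`abs_sub_partialSum_le_of_contDiff_top`), with no Sturm–Liouville argument. Nothing is claimed about (N).

Blind lane: Mathlib + the HodgeRepro2 prefix only; no sorry; axioms ⊆ {propext, Classical.choice,
Quot.sound}.
-/

namespace Summit.Ventures.HodgeRepro2.T5SU11LegendreLebesgue

open Polynomial intervalIntegral Finset Filter Topology MeasureTheory
open Set (Icc Ioo Ioc uIoc)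
open T5SU11SphericalLegendreAll T5SU11JacobiPhaseLawEven T5SU11JacobiLegendreLeading T5SU11LegendreIdentities
  T5SU11LegendreOrthogonal T5SU11LegendreOrthogonalLower T5SU11LegendreBound T5SU11LegendreExpansion
  T5SU11LegendreSeries T5SU11GaussLegendreTaylorError

/-! ### Linearity and the bound on the coefficients -/

/-- `c_k(f − g) = c_k(f) − c_k(g)` for `f, g` continuous on `[−1, 1]`. -/
theorem fourierLegendre_sub {f g : ℝ → ℝ} (hf : ContinuousOn f (Icc (-1 : ℝ) 1))
    (hg : ContinuousOn g (Icc (-1 : ℝ) 1)) (k : ℕ) :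
    fourierLegendre (fun x => f x - g x) k = fourierLegendre f k - fourierLegendre g k := by
  simp only [fourierLegendre]
  rw [← mul_sub, ← integral_sub (intervalIntegrable_mul_continuous hf (continuous_legP k))
    (intervalIntegrable_mul_continuous hg (continuous_legP k))]
  congr 1
  refine integral_congr fun x _ => ?_
  ring

/-- `S_d (f − g) = S_d f − S_d g` for `f, g` continuous on `[−1, 1]`. -/
theorem partialSum_sub {f g : ℝ → ℝ} (hf : ContinuousOn f (Icc (-1 : ℝ) 1))
    (hg : ContinuousOn g (Icc (-1 : ℝ) 1)) (d : ℕ) (x : ℝ) :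
    partialSum (fun x => f x - g x) d x = partialSum f d x - partialSum g d x := by
  simp only [partialSum, fourierLegendre_sub hf hg, sub_mul, Finset.sum_sub_distrib]

/-- **`|c_k(g)| ≤ (2k + 1) C` whenever `|g| ≤ C` on `[−1, 1]`** (`|∫ g P_k| ≤ 2C` with `|P_k| ≤ 1`). -/
theorem abs_fourierLegendre_le {g : ℝ → ℝ} {C : ℝ} (hg : ∀ x ∈ Icc (-1 : ℝ) 1, |g x| ≤ C) (k : ℕ) :
    |fourierLegendre g k| ≤ (2 * (k : ℝ) + 1) * C := by
  have hC : 0 ≤ C := (abs_nonneg _).trans (hg 0 (by norm_num))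
  have hint : |∫ x in (-1 : ℝ)..1, g x * legP k x| ≤ C * |(1 : ℝ) - (-1)| := by
    have := norm_integral_le_of_norm_le_const (a := (-1 : ℝ)) (b := 1) (C := C)
      (f := fun x => g x * legP k x) fun x hx => by
        have hx' : x ∈ Icc (-1 : ℝ) 1 := by
          rw [Set.uIoc_of_le (by norm_num)] at hx
          exact Set.Ioc_subset_Icc_self hx
        rw [Real.norm_eq_abs, abs_mul]
        calc |g x| * |legP k x| ≤ C * 1 := mul_le_mul (hg x hx') (abs_legP_le_one k hx') (abs_nonneg _) hC
          _ = C := mul_one C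
    simpa only [Real.norm_eq_abs] using this
  rw [fourierLegendre, abs_mul, abs_of_pos (by positivity : (0 : ℝ) < (2 * (k : ℝ) + 1) / 2)]
  calc (2 * (k : ℝ) + 1) / 2 * |∫ x in (-1 : ℝ)..1, g x * legP k x|
      ≤ (2 * (k : ℝ) + 1) / 2 * (C * |(1 : ℝ) - (-1)|) := mul_le_mul_of_nonneg_left hint (by positivity)
    _ = (2 * (k : ℝ) + 1) * C := by norm_num; ring

/-- `Σ_{k ≤ d} (2k + 1) = (d + 1)²`. -/
theorem sum_two_mul_add_one (d : ℕ) : ∑ k ∈ range (d + 1), (2 * (k : ℝ) + 1) = ((d : ℝ) + 1) ^ 2 := by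
  induction d with
  | zero => simp
  | succ d ih =>
    rw [Finset.sum_range_succ, ih]
    push_cast
    ring

/-- **The crude Lebesgue constant**: `|S_d g(x)| ≤ (d + 1)² C` on `[−1, 1]` whenever `|g| ≤ C` on `[−1, 1]`. -/
theorem abs_partialSum_le {g : ℝ → ℝ} {C : ℝ} (hg : ∀ x ∈ Icc (-1 : ℝ) 1, |g x| ≤ C) (d : ℕ) {x : ℝ}
    (hx : x ∈ Icc (-1 : ℝ) 1) : |partialSum g d x| ≤ ((d : ℝ) + 1) ^ 2 * C := by
  have hC : 0 ≤ C := (abs_nonneg _).trans (hg 0 (by norm_num))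
  calc |partialSum g d x| ≤ ∑ k ∈ range (d + 1), |fourierLegendre g k * legP k x| :=
        Finset.abs_sum_le_sum_abs _ _
    _ ≤ ∑ k ∈ range (d + 1), (2 * (k : ℝ) + 1) * C := by
        refine Finset.sum_le_sum fun k _ => ?_
        rw [abs_mul]
        calc |fourierLegendre g k| * |legP k x| ≤ (2 * (k : ℝ) + 1) * C * 1 :=
              mul_le_mul (abs_fourierLegendre_le hg k) (abs_legP_le_one k hx) (abs_nonneg _) (by positivity)
          _ = (2 * (k : ℝ) + 1) * C := mul_one _
    _ = ((d : ℝ) + 1) ^ 2 * C := by rw [← Finset.sum_mul, sum_two_mul_add_one]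

/-! ### Lebesgue's inequality -/

/-- `S_d p = p` for every polynomial `p` of degree `≤ d` (row 409's expansion). -/
theorem partialSum_eval_eq {d : ℕ} {p : ℝ[X]} (hp : p.natDegree ≤ d) (x : ℝ) :
    partialSum (fun x => p.eval x) d x = p.eval x := by
  rw [partialSum, eval_eq_sum_legendreCoeff hp x]
  refine Finset.sum_congr rfl fun k _ => ?_
  rw [fourierLegendre, legendreCoeff]

/-- **LEBESGUE'S INEQUALITY**: `|f(x) − S_d f(x)| ≤ (1 + (d + 1)²) M` on `[−1, 1]` whenever `|f − p| ≤ M` on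
`[−1, 1]` for some polynomial `p` of degree `≤ d`. -/
theorem abs_sub_partialSum_le_of_polynomial {f : ℝ → ℝ} (hf : ContinuousOn f (Icc (-1 : ℝ) 1)) {d : ℕ}
    {p : ℝ[X]} (hp : p.natDegree ≤ d) {M : ℝ} (hM : ∀ x ∈ Icc (-1 : ℝ) 1, |f x - p.eval x| ≤ M) {x : ℝ}
    (hx : x ∈ Icc (-1 : ℝ) 1) : |f x - partialSum f d x| ≤ (1 + ((d : ℝ) + 1) ^ 2) * M := by
  have hpc : ContinuousOn (fun x => p.eval x) (Icc (-1 : ℝ) 1) := p.continuous.continuousOn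
  have e : f x - partialSum f d x = (f x - p.eval x) - partialSum (fun x => f x - p.eval x) d x := by
    rw [partialSum_sub hf hpc, partialSum_eval_eq hp]
    ring
  rw [e]
  calc |(f x - p.eval x) - partialSum (fun x => f x - p.eval x) d x|
      ≤ |f x - p.eval x| + |partialSum (fun x => f x - p.eval x) d x| := abs_sub _ _
    _ ≤ M + ((d : ℝ) + 1) ^ 2 * M := add_le_add (hM x hx) (abs_partialSum_le hM d hx)
    _ = (1 + ((d : ℝ) + 1) ^ 2) * M := by ring

/-! ### Smooth functions -/

/-- **`|f − S_d f| ≤ (1 + (d + 1)²) C/(d + 1)!`** on `[−1, 1]` for `f ∈ C^{d+1}(ℝ)` with `|f^{(d+1)}| ≤ C` on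
`[−1, 1]` (Lebesgue's inequality with the Taylor polynomial of row 424). -/
theorem abs_sub_partialSum_le_of_contDiff {f : ℝ → ℝ} {d : ℕ} (hf : ContDiff ℝ (d + 1) f) {C : ℝ}
    (hC : ∀ x ∈ Icc (-1 : ℝ) 1, |iteratedDeriv (d + 1) f x| ≤ C) {x : ℝ} (hx : x ∈ Icc (-1 : ℝ) 1) :
    |f x - partialSum f d x| ≤ (1 + ((d : ℝ) + 1) ^ 2) * (C / (d + 1).factorial) :=
  abs_sub_partialSum_le_of_polynomial hf.continuous.continuousOn (natDegree_taylorPoly_le f d)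
    (fun _ hy => abs_sub_taylorPoly_le hf hC hy) hx

/-- **Super-exponential convergence** for `f ∈ C^∞` with `|f^{(k)}| ≤ C` on `[−1, 1]` for every `k`:
`|f − S_d f| ≤ (1 + (d + 1)²) C/(d + 1)!` for every `d`. -/
theorem abs_sub_partialSum_le_of_contDiff_top {f : ℝ → ℝ} (hf : ContDiff ℝ (⊤ : ℕ∞) f) {C : ℝ}
    (hC : ∀ k, ∀ x ∈ Icc (-1 : ℝ) 1, |iteratedDeriv k f x| ≤ C) (d : ℕ) {x : ℝ} (hx : x ∈ Icc (-1 : ℝ) 1) :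
    |f x - partialSum f d x| ≤ (1 + ((d : ℝ) + 1) ^ 2) * (C / (d + 1).factorial) :=
  abs_sub_partialSum_le_of_contDiff (hf.of_le (WithTop.coe_le_coe.mpr le_top)) (hC (d + 1)) hx

end Summit.Ventures.HodgeRepro2.T5SU11LegendreLebesgue
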